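import Mathlib
import Literature.MathematicalPhysics.StatisticalMechanics.LennardJonesClusters
import Literature.MathematicalPhysics.StatisticalMechanics.MatchedWindowTransfer
import HarnessLib

/-!
# Changed-pair sums of a configuration and of its matched reference window

The abstract perturbative-transfer estimate behind the restacking competitors of route
`SquareWellLayerCake`, crux `StackingFaultSparsity` (stmt-AtomisticToContinuum-14296, survey
obligation M3d), separated from the lattice geometry.  Data: a configuration `x : Fin N → ℝ³` with a
displacement field `dX`, a reference window `P : Fin N' → ℝ³` with a displacement field `dP`, an
embedding `φ : Fin N' ↪ Fin N` (the matching) and a linear isometry `A` transporting the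
displacements, `dX (φ m) = A (dP m)`, `dX = 0` off the image of `φ`.  For a pair potential `V` with
`|V a - V b| ≤ C_L (a⁻⁶ + b⁻⁶) |a - b|` on `[r₀, ∞)` and `|V r| ≤ r⁻⁶` on `[1, ∞)`, the
**changed-pair sums** `∑_{i<j, d i ≠ d j} (V |y_i + d_i - y_j - d_j| - V |y_i - y_j|)` of `(x, dX)`
and of `(P, dP)` differ by at most `#{m : dP m ≠ 0} · (2000 C_L r₀⁻⁶ ε + 195 C_T ℓ⁻³)`
(`abs_changedPairs_sub_changedPairs_le`), provided

* `x`, `P`, `P + dP` and `m ↦ x (φ m) + A (dP m)` are `r₀`-separated and the far tails of `x` obey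
  `∑_{|x_i - x_j| ≥ ℓ'} |x_i - x_j|⁻⁶ ≤ C_T ℓ'⁻³` (`ℓ' ≥ r₀`);
* matched distances agree within `2ε` before and after the displacement;
* `‖dP m‖ ≤ 3/5`, and a particle off the image of `φ` is `≥ ℓ + 3/4` (`ℓ ≥ 7/5`, `ℓ ≥ r₀`) from
  every `x (φ m)` with `dP m ≠ 0`.

Proof: both sums are halves of full double sums (`sum_sum_eq_two_mul_sum_Ioi`); the one of `x` is
transported along `φ` (`sum_sum_eq_of_embedding`); matched pairs are compared by the Lipschitz bound
and the shell sums `sum_univ_inv_pow_six_le` over the four separated configurations (each moved `m`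
costs `≤ 2000 C_L r₀⁻⁶ ε`, bookkeeping `sum_sum_add_mul_of_symm`); the partners off the image are a
far tail at range `ℓ` (`|V| ≤ r⁻⁶`, `(r - 3/5)⁻⁶ ≤ 64 r⁻⁶` for `r ≥ 2`).  All folklore.
-/

noncomputable section

open scoped BigOperators

namespace Literature.MathematicalPhysics.StatisticalMechanics

/-- **Perturbative transfer of changed-pair sums** (see the module docstring for the setting):
`|Δ(x, dX) - Δ(P, dP)| ≤ #{m : dP m ≠ 0} · (2000 C_L r₀⁻⁶ ε + 195 C_T ℓ⁻³)`. [folklore] -/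
theorem abs_changedPairs_sub_changedPairs_le {N N' : ℕ} (V : ℝ → ℝ) {r₀ CL CT ε ℓ : ℝ}
    (x dX : Fin N → EuclideanSpace ℝ (Fin 3)) (P dP : Fin N' → EuclideanSpace ℝ (Fin 3))
    (φ : Fin N' ↪ Fin N) (A : EuclideanSpace ℝ (Fin 3) →ₗᵢ[ℝ] EuclideanSpace ℝ (Fin 3))
    (hr₀ : 0 < r₀) (hCL : 0 ≤ CL) (hCT : 0 ≤ CT) (hε : 0 ≤ ε) (hℓ : 7 / 5 ≤ ℓ) (hr₀ℓ : r₀ ≤ ℓ)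
    (hV : ∀ a b, r₀ ≤ a → r₀ ≤ b → |V a - V b| ≤ CL * (a⁻¹ ^ 6 + b⁻¹ ^ 6) * |a - b|)
    (hV1 : ∀ r, 1 ≤ r → |V r| ≤ r⁻¹ ^ 6)
    (hsep : ∀ j j', j ≠ j' → r₀ ≤ dist (x j) (x j'))
    (htail : ∀ (i : Fin N) (ℓ' : ℝ), r₀ ≤ ℓ' →
      ∑ j ∈ (Finset.univ.erase i).filter (fun j => ℓ' ≤ dist (x i) (x j)),
        (dist (x i) (x j))⁻¹ ^ 6 ≤ CT * ℓ'⁻¹ ^ 3)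
    (hdX : ∀ m, dX (φ m) = A (dP m)) (hdX0 : ∀ j, j ∉ Set.range φ → dX j = 0)
    (hsepP : ∀ m m', m ≠ m' → r₀ ≤ dist (P m) (P m'))
    (hsepQ : ∀ m m', m ≠ m' → r₀ ≤ dist (P m + dP m) (P m' + dP m'))
    (hsepY : ∀ m m', m ≠ m' → r₀ ≤ dist (x (φ m) + A (dP m)) (x (φ m') + A (dP m')))
    (hclose : ∀ m m', |dist (x (φ m)) (x (φ m')) - dist (P m) (P m')| ≤ 2 * ε)
    (hclose' : ∀ m m', |dist (x (φ m) + A (dP m)) (x (φ m') + A (dP m')) -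
      dist (P m + dP m) (P m' + dP m')| ≤ 2 * ε)
    (hnorm : ∀ m, ‖dP m‖ ≤ 3 / 5)
    (hfar : ∀ m j, dP m ≠ 0 → j ∉ Set.range φ → ℓ + 3 / 4 ≤ dist (x (φ m)) (x j)) :
    |(∑ j, ∑ j' ∈ Finset.Ioi j, (if dX j = dX j' then 0 else
        V (dist (x j + dX j) (x j' + dX j')) - V (dist (x j) (x j')))) -
      (∑ m, ∑ m' ∈ Finset.Ioi m, (if dP m = dP m' then 0 else
        V (dist (P m + dP m) (P m' + dP m')) - V (dist (P m) (P m'))))| ≤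
      ((Finset.univ.filter fun m => dP m ≠ 0).card : ℝ) *
        (2000 * CL * r₀⁻¹ ^ 6 * ε + 195 * CT * ℓ⁻¹ ^ 3) := by
  set y' : Fin N' → EuclideanSpace ℝ (Fin 3) := fun m => x (φ m) + A (dP m) with hy'
  set Q : Fin N' → EuclideanSpace ℝ (Fin 3) := fun m => P m + dP m with hQ
  have hsepXφ : ∀ m m', m ≠ m' → r₀ ≤ dist (x (φ m)) (x (φ m')) := fun m m' hne =>
    hsep _ _ (φ.injective.ne hne)
  have hrangeW : ∀ j, j ∉ Finset.univ.map φ → j ∉ Set.range φ := fun j hj ⟨m, hm⟩ =>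
    hj (Finset.mem_map.2 ⟨m, Finset.mem_univ _, hm⟩)
  -- the pair functionals
  set FX : Fin N → Fin N → ℝ := fun j j' =>
    if dX j = dX j' then 0 else V (dist (x j + dX j) (x j' + dX j')) - V (dist (x j) (x j'))
    with hFX
  set FP : Fin N' → Fin N' → ℝ := fun m m' =>
    if dP m = dP m' then 0 else V (dist (Q m) (Q m')) - V (dist (P m) (P m')) with hFP
  change |(∑ j, ∑ j' ∈ Finset.Ioi j, FX j j') - ∑ m, ∑ m' ∈ Finset.Ioi m, FP m m'| ≤ _
  have hFXs : ∀ j j', FX j j' = FX j' j := by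
    intro j j'
    simp only [hFX]
    by_cases h0 : dX j = dX j'
    · rw [if_pos h0, if_pos h0.symm]
    · rw [if_neg h0, if_neg (Ne.symm h0), dist_comm (x j + dX j), dist_comm (x j)]
  have hFXd : ∀ j, FX j j = 0 := fun j => by simp only [hFX, if_true]
  have hFPs : ∀ m m', FP m m' = FP m' m := by
    intro m m'
    simp only [hFP]
    by_cases h0 : dP m = dP m'
    · rw [if_pos h0, if_pos h0.symm]
    · rw [if_neg h0, if_neg (Ne.symm h0), dist_comm (Q m), dist_comm (P m)]
  have hFPd : ∀ m, FP m m = 0 := fun m => by simp only [hFP, if_true]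
  have h2X := sum_sum_eq_two_mul_sum_Ioi FX hFXs hFXd
  have h2P := sum_sum_eq_two_mul_sum_Ioi FP hFPs hFPd
  have hX00 : ∀ j j', j ∉ Finset.univ.map φ → j' ∉ Finset.univ.map φ → FX j j' = 0 := by
    intro j j' hj hj'
    simp only [hFX, hdX0 j (hrangeW j hj), hdX0 j' (hrangeW j' hj'), if_true]
  have hsplit := sum_sum_eq_of_embedding FX hFXs φ hX00
  have hFXφ : ∀ m m', FX (φ m) (φ m') =
      if dP m = dP m' then 0 else V (dist (y' m) (y' m')) - V (dist (x (φ m)) (x (φ m'))) := by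
    intro m m'
    simp only [hFX, hy', hdX, A.injective.eq_iff]
  -- (a) matched pairs, term by term
  set B : Fin N' → Fin N' → ℝ := fun m m' => 2 * ε * CL *
    ((dist (x (φ m)) (x (φ m')))⁻¹ ^ 6 + (dist (P m) (P m'))⁻¹ ^ 6 +
      (dist (y' m) (y' m'))⁻¹ ^ 6 + (dist (Q m) (Q m'))⁻¹ ^ 6) with hB
  have hB0 : ∀ m m', 0 ≤ B m m' := fun m m' => by simp only [hB]; positivity
  have hBs : ∀ m m', B m m' = B m' m := by
    intro m m'
    simp only [hB, dist_comm (x (φ m)), dist_comm (P m), dist_comm (y' m), dist_comm (Q m)]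
  set ind : Fin N' → ℝ := fun m => if dP m = 0 then 0 else 1 with hind
  have hind0 : ∀ m, 0 ≤ ind m := fun m => by simp only [hind]; split_ifs <;> norm_num
  have hpair : ∀ m m', |FX (φ m) (φ m') - FP m m'| ≤ (ind m + ind m') * B m m' := by
    intro m m'
    rw [hFXφ]
    simp only [hFP]
    by_cases hd : dP m = dP m'
    · rw [if_pos hd, if_pos hd, sub_self, abs_zero]
      exact mul_nonneg (add_nonneg (hind0 m) (hind0 m')) (hB0 m m')
    · have hne : m ≠ m' := fun h0 => hd (by rw [h0])
      rw [if_neg hd, if_neg hd]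
      have hi : 1 ≤ ind m + ind m' := by
        simp only [hind]
        split_ifs with h0 h0'
        · exact absurd (h0.trans h0'.symm) hd
        all_goals norm_num
      have e1 : |V (dist (y' m) (y' m')) - V (dist (Q m) (Q m'))| ≤
          CL * ((dist (y' m) (y' m'))⁻¹ ^ 6 + (dist (Q m) (Q m'))⁻¹ ^ 6) * (2 * ε) :=
        (hV _ _ (hsepY m m' hne) (hsepQ m m' hne)).trans
          (mul_le_mul_of_nonneg_left (hclose' m m') (by positivity))
      have e2 : |V (dist (x (φ m)) (x (φ m'))) - V (dist (P m) (P m'))| ≤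
          CL * ((dist (x (φ m)) (x (φ m')))⁻¹ ^ 6 + (dist (P m) (P m'))⁻¹ ^ 6) * (2 * ε) :=
        (hV _ _ (hsepXφ m m' hne) (hsepP m m' hne)).trans
          (mul_le_mul_of_nonneg_left (hclose m m') (by positivity))
      have e3 : |(V (dist (y' m) (y' m')) - V (dist (x (φ m)) (x (φ m')))) -
          (V (dist (Q m) (Q m')) - V (dist (P m) (P m')))| ≤ B m m' := by
        rw [show ∀ p q r t : ℝ, (p - q) - (r - t) = (p - r) - (q - t) from fun _ _ _ _ => by ring]
        refine (abs_sub _ _).trans ?_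
        have eB : B m m' = CL * ((dist (y' m) (y' m'))⁻¹ ^ 6 + (dist (Q m) (Q m'))⁻¹ ^ 6) * (2 * ε) +
            CL * ((dist (x (φ m)) (x (φ m')))⁻¹ ^ 6 + (dist (P m) (P m'))⁻¹ ^ 6) * (2 * ε) := by
          simp only [hB]; ring
        rw [eB]
        exact add_le_add e1 e2
      calc _ ≤ B m m' := e3
        _ = 1 * B m m' := (one_mul _).symm
        _ ≤ (ind m + ind m') * B m m' := mul_le_mul_of_nonneg_right hi (hB0 m m')
  -- (b) row sums of `B`
  have hrow : ∀ m, ∑ m', B m m' ≤ 2000 * CL * r₀⁻¹ ^ 6 * ε := by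
    intro m
    have s1 : ∑ m', (dist (x (φ m)) (x (φ m')))⁻¹ ^ 6 ≤ 250 * r₀⁻¹ ^ 6 :=
      sum_univ_inv_pow_six_le (fun m => x (φ m)) hr₀ hsepXφ m
    have s2 : ∑ m', (dist (P m) (P m'))⁻¹ ^ 6 ≤ 250 * r₀⁻¹ ^ 6 :=
      sum_univ_inv_pow_six_le P hr₀ hsepP m
    have s3 : ∑ m', (dist (y' m) (y' m'))⁻¹ ^ 6 ≤ 250 * r₀⁻¹ ^ 6 :=
      sum_univ_inv_pow_six_le y' hr₀ hsepY m
    have s4 : ∑ m', (dist (Q m) (Q m'))⁻¹ ^ 6 ≤ 250 * r₀⁻¹ ^ 6 :=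
      sum_univ_inv_pow_six_le Q hr₀ hsepQ m
    have e : ∑ m', B m m' = 2 * ε * CL * (∑ m', (dist (x (φ m)) (x (φ m')))⁻¹ ^ 6 +
        ∑ m', (dist (P m) (P m'))⁻¹ ^ 6 + ∑ m', (dist (y' m) (y' m'))⁻¹ ^ 6 +
        ∑ m', (dist (Q m) (Q m'))⁻¹ ^ 6) := by
      simp only [hB, ← Finset.mul_sum, Finset.sum_add_distrib]
    rw [e]
    have : 2 * ε * CL * (250 * r₀⁻¹ ^ 6 + 250 * r₀⁻¹ ^ 6 + 250 * r₀⁻¹ ^ 6 + 250 * r₀⁻¹ ^ 6) =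
        2000 * CL * r₀⁻¹ ^ 6 * ε := by ring
    rw [← this]
    exact mul_le_mul_of_nonneg_left (by linarith) (by positivity)
  have hA : ∑ m, ∑ m', |FX (φ m) (φ m') - FP m m'| ≤
      2 * ((∑ m, ind m) * (2000 * CL * r₀⁻¹ ^ 6 * ε)) :=
    calc ∑ m, ∑ m', |FX (φ m) (φ m') - FP m m'| ≤ ∑ m, ∑ m', (ind m + ind m') * B m m' :=
          Finset.sum_le_sum fun m _ => Finset.sum_le_sum fun m' _ => hpair m m'
      _ = 2 * ∑ m, ind m * ∑ m', B m m' := sum_sum_add_mul_of_symm B hBs ind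
      _ ≤ 2 * ∑ m, ind m * (2000 * CL * r₀⁻¹ ^ 6 * ε) :=
          mul_le_mul_of_nonneg_left (Finset.sum_le_sum fun m _ =>
            mul_le_mul_of_nonneg_left (hrow m) (hind0 m)) (by norm_num)
      _ = 2 * ((∑ m, ind m) * (2000 * CL * r₀⁻¹ ^ 6 * ε)) := by rw [Finset.sum_mul]
  -- (c) tails: the partners off the image of a moved particle
  have htl : ∀ m, ∑ j' ∈ (Finset.univ.map φ)ᶜ, |FX (φ m) j'| ≤ ind m * (195 * CT * ℓ⁻¹ ^ 3) := by
    intro m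
    by_cases hm : dP m = 0
    · have h0 : ∀ j' ∈ (Finset.univ.map φ)ᶜ, |FX (φ m) j'| = 0 := by
        intro j' hj'
        have h0 := hdX0 j' (hrangeW j' (Finset.mem_compl.1 hj'))
        simp only [hFX, hdX, hm, map_zero, h0, if_true, abs_zero]
      have hind1 : ind m = 0 := by
        show (if dP m = 0 then (0 : ℝ) else 1) = 0
        rw [if_pos hm]
      rw [Finset.sum_congr rfl h0, Finset.sum_const_zero, hind1, zero_mul]
    · have hnorm' : ‖A (dP m)‖ ≤ 3 / 5 := by rw [LinearIsometry.norm_map]; exact hnorm m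
      have hAne : A (dP m) ≠ 0 := fun h0 => hm (by
        have := congrArg (fun v => ‖v‖) h0
        simpa [LinearIsometry.norm_map] using this)
      have hterm : ∀ j' ∈ (Finset.univ.map φ)ᶜ,
          |FX (φ m) j'| ≤ 65 * (dist (x (φ m)) (x j'))⁻¹ ^ 6 := by
        intro j' hj'
        have hj'r := hrangeW j' (Finset.mem_compl.1 hj')
        have hD := hfar m j' hm hj'r
        have h0 := hdX0 j' hj'r
        have hval : FX (φ m) j' = V (dist (y' m) (x j')) - V (dist (x (φ m)) (x j')) := by
          simp only [hFX, hdX, h0, add_zero, hy']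
          rw [if_neg hAne]
        have hD2 : 2 ≤ dist (x (φ m)) (x j') := by linarith
        have hD' : dist (x (φ m)) (x j') - 3 / 5 ≤ dist (y' m) (x j') := by
          have h1 := dist_triangle (x (φ m)) (y' m) (x j')
          have e : dist (x (φ m)) (y' m) = ‖A (dP m)‖ := by
            simp only [hy']
            rw [dist_self_add_right]
          linarith
        have hD'1 : 1 ≤ dist (y' m) (x j') := by linarith
        have hD'2 : dist (x (φ m)) (x j') / 2 ≤ dist (y' m) (x j') := by linarith
        have v1 : |V (dist (y' m) (x j'))| ≤ 64 * (dist (x (φ m)) (x j'))⁻¹ ^ 6 := by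
          refine (hV1 _ hD'1).trans ?_
          have h1 : (dist (y' m) (x j'))⁻¹ ≤ (dist (x (φ m)) (x j') / 2)⁻¹ :=
            inv_anti₀ (by positivity) hD'2
          calc (dist (y' m) (x j'))⁻¹ ^ 6 ≤ (dist (x (φ m)) (x j') / 2)⁻¹ ^ 6 :=
                pow_le_pow_left₀ (inv_nonneg.2 dist_nonneg) h1 6
            _ = 64 * (dist (x (φ m)) (x j'))⁻¹ ^ 6 := by
                rw [inv_div, div_eq_mul_inv, mul_pow]; norm_num
        have v2 : |V (dist (x (φ m)) (x j'))| ≤ (dist (x (φ m)) (x j'))⁻¹ ^ 6 :=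
          hV1 _ (by linarith)
        rw [hval]
        calc _ ≤ |V (dist (y' m) (x j'))| + |V (dist (x (φ m)) (x j'))| := abs_sub _ _
          _ ≤ 64 * (dist (x (φ m)) (x j'))⁻¹ ^ 6 + (dist (x (φ m)) (x j'))⁻¹ ^ 6 :=
              add_le_add v1 v2
          _ = 65 * (dist (x (φ m)) (x j'))⁻¹ ^ 6 := by ring
      have hsub : (Finset.univ.map φ)ᶜ ⊆
          (Finset.univ.erase (φ m)).filter (fun j' => ℓ ≤ dist (x (φ m)) (x j')) := by
        intro j' hj'
        have hj'r := hrangeW j' (Finset.mem_compl.1 hj')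
        refine Finset.mem_filter.2 ⟨Finset.mem_erase.2 ⟨?_, Finset.mem_univ _⟩, ?_⟩
        · rintro rfl
          exact hj'r ⟨m, rfl⟩
        · linarith [hfar m j' hm hj'r]
      have ht := htail (φ m) ℓ hr₀ℓ
      have hind1 : ind m = 1 := by
        show (if dP m = 0 then (0 : ℝ) else 1) = 1
        rw [if_neg hm]
      rw [hind1, one_mul]
      calc ∑ j' ∈ (Finset.univ.map φ)ᶜ, |FX (φ m) j'|
          ≤ ∑ j' ∈ (Finset.univ.map φ)ᶜ, 65 * (dist (x (φ m)) (x j'))⁻¹ ^ 6 :=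
            Finset.sum_le_sum hterm
        _ ≤ ∑ j' ∈ (Finset.univ.erase (φ m)).filter (fun j' => ℓ ≤ dist (x (φ m)) (x j')),
              65 * (dist (x (φ m)) (x j'))⁻¹ ^ 6 :=
            Finset.sum_le_sum_of_subset_of_nonneg hsub fun _ _ _ => by positivity
        _ = 65 * ∑ j' ∈ (Finset.univ.erase (φ m)).filter (fun j' => ℓ ≤ dist (x (φ m)) (x j')),
              (dist (x (φ m)) (x j'))⁻¹ ^ 6 := by
            rw [Finset.mul_sum]
        _ ≤ 65 * (CT * ℓ⁻¹ ^ 3) := mul_le_mul_of_nonneg_left ht (by norm_num)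
        _ ≤ 195 * CT * ℓ⁻¹ ^ 3 := by nlinarith [pow_nonneg (inv_nonneg.2 (by linarith : (0:ℝ) ≤ ℓ)) 3]
  -- (d) assembly
  have hcard : ∑ m, ind m = ((Finset.univ.filter fun m => dP m ≠ 0).card : ℝ) := by
    simp only [hind]
    rw [Finset.sum_ite, Finset.sum_const_zero, zero_add, Finset.sum_const, nsmul_eq_mul, mul_one]
  have hS0 : 0 ≤ ∑ m, ind m := Finset.sum_nonneg fun m _ => hind0 m
  have hdiff : 2 * ((∑ j, ∑ j' ∈ Finset.Ioi j, FX j j') - ∑ m, ∑ m' ∈ Finset.Ioi m, FP m m') =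
      ∑ m, ∑ m', (FX (φ m) (φ m') - FP m m') +
        2 * ∑ m, ∑ j' ∈ (Finset.univ.map φ)ᶜ, FX (φ m) j' := by
    rw [mul_sub, ← h2X, ← h2P, hsplit]
    simp only [Finset.sum_sub_distrib]
    ring
  have hB1 : |∑ m, ∑ m', (FX (φ m) (φ m') - FP m m')| ≤
      2 * ((∑ m, ind m) * (2000 * CL * r₀⁻¹ ^ 6 * ε)) :=
    (Finset.abs_sum_le_sum_abs _ _).trans
      ((Finset.sum_le_sum fun m _ => Finset.abs_sum_le_sum_abs _ _).trans hA)
  have hB2 : |∑ m, ∑ j' ∈ (Finset.univ.map φ)ᶜ, FX (φ m) j'| ≤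
      (∑ m, ind m) * (195 * CT * ℓ⁻¹ ^ 3) := by
    refine (Finset.abs_sum_le_sum_abs _ _).trans ?_
    refine (Finset.sum_le_sum fun m _ => Finset.abs_sum_le_sum_abs _ _).trans ?_
    rw [Finset.sum_mul]
    exact Finset.sum_le_sum fun m _ => htl m
  have h2 : |2 * ((∑ j, ∑ j' ∈ Finset.Ioi j, FX j j') - ∑ m, ∑ m' ∈ Finset.Ioi m, FP m m')| ≤
      2 * ((∑ m, ind m) * (2000 * CL * r₀⁻¹ ^ 6 * ε)) +
        2 * ((∑ m, ind m) * (195 * CT * ℓ⁻¹ ^ 3)) := by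
    rw [hdiff]
    refine (abs_add_le _ _).trans ?_
    rw [abs_mul, abs_two]
    linarith [hB1, hB2]
  rw [abs_mul, abs_two] at h2
  rw [← hcard]
  linarith

end Literature.MathematicalPhysics.StatisticalMechanics

end
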